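import Mathlib
import Summits.ValiantsHypothesis.ValiantsHypothesis.Theses.FifoMatching
import Summits.ValiantsHypothesis.ValiantsHypothesis.Theorems.FifoMatchingNNNotVPStubSupportFnHard
import Summits.ValiantsHypothesis.ValiantsHypothesis.Theorems.FifoMatchingNNNotVPStubCertificateToSupportFn
import Summits.ValiantsHypothesis.ValiantsHypothesis.Theorems.FifoMatchingNNDivisionHardWindowAvoidance
import Summits.ValiantsHypothesis.ValiantsHypothesis.Theorems.FifoMatchingNNNotVPSplit
import Literature.Computability.AlgebraicComplexity.NestFreeMatchingPoly
import HarnessLib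

/-!
# Route FifoMatching — crux `NNDivisionHard` (stmt-ValiantsHypothesis-21181):
# the SMALL-SUPPORT-MONOMIAL rung and the residual enemy class BY NAME (cheap ∧ window-dense ∧ deep ∧ spread)

`NNDivisionHard`: for every `c` and all large `n`, EVERY nonzero cofactor `h ∈ ℝ≥0[x_(i,j)]` has
`2^((log₂ n + c)^c) < L₊(NN_n · h) + L₊(h)`.  Three EXISTENTIAL rungs of record decide a cofactor from ONE of
its monomials, whatever its degree and whatever the other monomials:

* the ORDER rung (`NNOrderRung.orderRung_of_rung` ∘ ✓ `nnQuasiPolyLogDegreeCofactorHard_holds`, stmt-27271):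
  some homogeneous component of degree `≤ 2^((log₂ n + k)^k)` is nonzero;
* the WINDOW-AVOIDANCE rung (`NNDivisionHard.WindowAvoidance.nnDivisionHard_of_windowAvoidingMonomial`,
  val-idea-40 g9, ported): some monomial avoids a window of `2·((log₂ n + c)^c + log₂ n + 1)^6 + 12`
  consecutive vertices;
* NEW HERE AS A RUNG — `nnDivisionHard_of_smallSupportMonomial`: some monomial uses at most `(log₂ n + k)^k`
  DISTINCT arc variables (any multiplicities).  It is the composition of the two landed stubs of line
  `division_split` of crux `NNNotVP` (stmt-11615): B1 `stub_certificateToSupportFn` (p582087: freeing the arcs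
  of a monomial `x^m` of `h` in `NN_n · h` yields a polynomial with the SUPPORT FUNCTION of `NN_n|_{supp m := 1}`
  and no larger monotone complexity) and A `stub_supportFnHard` (p821759, leafhand g3: every nonnegative
  polynomial with that support function, `|supp m| ≤ (log₂ n + k)^k`, costs more than `2^((log₂ n + c)^c)` —
  nest-free-perfect-matching existence is CLIQUE-hard under monotone projections).

`nnDivisionHard_iff_spreadDenseDeepResidual` — BY NAME against the route decl: `Theses.FifoMatching.NNDivisionHard`
⟺ its restriction to nonzero cofactors that are, for all `k, c` eventually in `n`, simultaneously
CHEAP (`L₊(h) ≤ 2^((log₂ n + c)^c)`), WINDOW-DENSE (every monomial meets every window), DEEP (every homogeneous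
component of degree `≤ 2^((log₂ n + k)^k)` vanishes) and SPREAD (every monomial uses MORE than `(log₂ n + k)^k`
distinct arcs).  This is the exact residual enemy class of 21181 in `h`-language after the three existential
rungs; e.g. `(Π_{i<n} x_(2i,2i+1))^(3^n)` (one monomial: window-dense, deep, spread over `n` arcs) is in it for
the support-function and order engines but is decided by the monomial rung ✓ `nnMonomialCofactorHard_holds`
(translation-invariance of extension complexity) — the residual is not claimed minimal.

`nnNotVP_of_zeroOneTransfer_of_residual` — what the parent crux `NNNotVP` (stmt-11615) now hinges on, BY NAME: the
shared transfer `Theses.DivisionGap.ZeroOneTransfer` (stmt-5066 = stub Z of line `division_split`) and the residual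
statement above (the landed glue `NNNotVPSplit.nnNotVP_of_subs` ∘ the iff) — a CANDIDATE replacement, weaker than the
registered stub B2 `stub_spreadCofactorReduction` (which is of exponential type: it must produce a cofactor with a
polylog-support monomial at cost quasi-polynomial in `L₊(NN_n h) + L₊(h)`), for the planner's consideration only.

HONEST FRAMING.  Consolidation rung + residual by name; the crux `NNDivisionHard`, `NNNotVP` (stmt-11615; with
`ZeroOneTransfer` = stmt-5066 via the landed glue `nnNotVP_of_subs`) and VP ≠ VNP are NOT proved; monotone world
only (`Literature.Barriers.ValiantsHypothesis.MonotoneGap`).  No definitions, no named facts, no sorry. [folklore]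
-/

noncomputable section

-- Sub = Summit single-conjunct layout: the duplicated namespace component is mandated by the tree.
set_option linter.dupNamespace false
set_option autoImplicit false

namespace Summit.ValiantsHypothesis.ValiantsHypothesis.Theorems.FifoMatching.NNDivisionHard.Residual

open MvPolynomial Finset Literature.Computability.AlgebraicComplexity
open Summit.ValiantsHypothesis.ValiantsHypothesis.Theorems.FifoMatching.NNNotVP.DivisionSplit
  (NN SuppFn freeVars stub_supportFnHard stub_certificateToSupportFn)
open Summit.ValiantsHypothesis.ValiantsHypothesis.Theorems.FifoMatching.NNDivisionHard.WindowAvoidance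
  (nnDivisionHard_iff_denseDeepResidual)
open scoped NNReal

/-! ### §1 The small-support-monomial rung (B1 ∘ A of line `division_split`) -/

/-- **`NNDivisionHard` for cofactors with ONE monomial of polylogarithmic support** (any multiplicities, any
other monomials): for all `k, c` there is `n₀` such that for all `n ≥ n₀` and every `h ∈ ℝ≥0[x_(i,j)]` having a
monomial `x^m` with at most `(log₂ n + k)^k` distinct variables, `2^((log₂ n + c)^c) < L₊(NN_n · h) + L₊(h)`.
Proof: B1 `stub_certificateToSupportFn` then A `stub_supportFnHard`, by name. [folklore] -/
theorem nnDivisionHard_of_smallSupportMonomial (k c : ℕ) :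
    ∃ n₀ : ℕ, ∀ n ≥ n₀, ∀ h : MvPolynomial (Fin (2 * n) × Fin (2 * n)) ℝ≥0,
      (∃ m ∈ h.support, m.support.card ≤ (Nat.log 2 n + k) ^ k) →
      2 ^ ((Nat.log 2 n + c) ^ c) < complexity (nestFreeMatchingPoly n ℝ≥0 * h) + complexity h := by
  obtain ⟨n₀, hn₀⟩ := stub_supportFnHard k c
  refine ⟨n₀, fun n hn h hm => ?_⟩
  obtain ⟨m, hm, hcard⟩ := hm
  obtain ⟨g, hg, hgc⟩ := stub_certificateToSupportFn n h m hm
  calc 2 ^ ((Nat.log 2 n + c) ^ c) < complexity g := hn₀ n hn m.support hcard g hg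
    _ ≤ complexity (NN n * h) := hgc
    _ ≤ complexity (nestFreeMatchingPoly n ℝ≥0 * h) + complexity h := Nat.le_add_right _ _

/-- The same rung with the threshold of the crux on BOTH sides (`k := c`), as a one-parameter family. [folklore] -/
theorem nnDivisionHard_of_smallSupportMonomial' (c : ℕ) :
    ∃ n₀ : ℕ, ∀ n ≥ n₀, ∀ h : MvPolynomial (Fin (2 * n) × Fin (2 * n)) ℝ≥0,
      (∃ m ∈ h.support, m.support.card ≤ (Nat.log 2 n + c) ^ c) →
      2 ^ ((Nat.log 2 n + c) ^ c) < complexity (nestFreeMatchingPoly n ℝ≥0 * h) + complexity h :=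
  nnDivisionHard_of_smallSupportMonomial c c

/-! ### §2 The residual enemy class of 21181, BY NAME -/

/-- **`NNDivisionHard` ⟺ `NNDivisionHard` for CHEAP, WINDOW-DENSE, DEEP and SPREAD cofactors.**  For all `k, c`,
eventually in `n`, it suffices to treat the nonzero `h` with `L₊(h) ≤ 2^((log₂ n + c)^c)` (cheap), every monomial
meeting every window of `2·((log₂ n + c)^c + log₂ n + 1)^6 + 12` consecutive vertices (window-dense), all
homogeneous components of degree `≤ 2^((log₂ n + k)^k)` zero (deep) and every monomial using more than
`(log₂ n + k)^k` distinct arcs (spread); the other cofactors are decided by the trivial bound, the window-avoidance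
rung, the order rung and §1 respectively.  (`NN_n` inlined in the route decl is definitionally
`nestFreeMatchingPoly n ℝ≥0`.) [folklore] -/
theorem nnDivisionHard_iff_spreadDenseDeepResidual :
    Summit.ValiantsHypothesis.ValiantsHypothesis.Theses.FifoMatching.NNDivisionHard ↔
      ∀ k c : ℕ, ∃ n₀ : ℕ, ∀ n ≥ n₀, ∀ h : MvPolynomial (Fin (2 * n) × Fin (2 * n)) ℝ≥0, h ≠ 0 →
        complexity h ≤ 2 ^ ((Nat.log 2 n + c) ^ c) →
        (∀ d ∈ h.support, ∀ s : ℕ,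
          s + (2 * ((Nat.log 2 n + c) ^ c + Nat.log 2 n + 1) ^ 6 + 12) ≤ 2 * n →
          ∃ e ∈ d.support,
            (s ≤ e.1.val ∧ e.1.val < s + (2 * ((Nat.log 2 n + c) ^ c + Nat.log 2 n + 1) ^ 6 + 12)) ∨
            (s ≤ e.2.val ∧ e.2.val < s + (2 * ((Nat.log 2 n + c) ^ c + Nat.log 2 n + 1) ^ 6 + 12))) →
        (∀ e : ℕ, e ≤ 2 ^ ((Nat.log 2 n + k) ^ k) → homogeneousComponent e h = 0) →
        (∀ d ∈ h.support, (Nat.log 2 n + k) ^ k < d.support.card) →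
        2 ^ ((Nat.log 2 n + c) ^ c) <
          complexity (nestFreeMatchingPoly n ℝ≥0 * h) + complexity h := by
  constructor
  · intro H k c
    obtain ⟨n₀, hn₀⟩ := H c
    exact ⟨n₀, fun n hn h hh _ _ _ _ => hn₀ n hn h hh⟩
  · intro H
    refine nnDivisionHard_iff_denseDeepResidual.mpr fun k c => ?_
    obtain ⟨n₁, hn₁⟩ := H k c
    obtain ⟨n₂, hn₂⟩ := nnDivisionHard_of_smallSupportMonomial k c
    refine ⟨max n₁ n₂, fun n hn h hh hdense hdeep => ?_⟩
    by_cases hcheap : complexity h ≤ 2 ^ ((Nat.log 2 n + c) ^ c)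
    · by_cases hsmall : ∃ m ∈ h.support, m.support.card ≤ (Nat.log 2 n + k) ^ k
      · exact hn₂ n (le_of_max_le_right hn) h hsmall
      · refine hn₁ n (le_of_max_le_left hn) h hh hcheap hdense hdeep fun d hd => ?_
        by_contra hle
        exact hsmall ⟨d, hd, not_lt.mp hle⟩
    · push Not at hcheap
      exact hcheap.trans_le (Nat.le_add_left _ _)

/-! ### §3 What the parent crux `NNNotVP` (stmt-11615) hinges on, BY NAME -/

/-- **`ZeroOneTransfer` + the residual ⇒ `NNNotVP`.**  The shared 0/1 division transfer (stmt-5066, stub Z of line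
`division_split`) and the cheap ∧ window-dense ∧ deep ∧ spread tier of `NNDivisionHard` give the crux `NNNotVP`
(landed glue `NNNotVPSplit.nnNotVP_of_subs`).  Both hypotheses are OPEN. [folklore] -/
theorem nnNotVP_of_zeroOneTransfer_of_residual
    (hZ : Summit.ValiantsHypothesis.ValiantsHypothesis.Theses.DivisionGap.ZeroOneTransfer)
    (hR : ∀ k c : ℕ, ∃ n₀ : ℕ, ∀ n ≥ n₀, ∀ h : MvPolynomial (Fin (2 * n) × Fin (2 * n)) ℝ≥0, h ≠ 0 →
        complexity h ≤ 2 ^ ((Nat.log 2 n + c) ^ c) →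
        (∀ d ∈ h.support, ∀ s : ℕ,
          s + (2 * ((Nat.log 2 n + c) ^ c + Nat.log 2 n + 1) ^ 6 + 12) ≤ 2 * n →
          ∃ e ∈ d.support,
            (s ≤ e.1.val ∧ e.1.val < s + (2 * ((Nat.log 2 n + c) ^ c + Nat.log 2 n + 1) ^ 6 + 12)) ∨
            (s ≤ e.2.val ∧ e.2.val < s + (2 * ((Nat.log 2 n + c) ^ c + Nat.log 2 n + 1) ^ 6 + 12))) →
        (∀ e : ℕ, e ≤ 2 ^ ((Nat.log 2 n + k) ^ k) → homogeneousComponent e h = 0) →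
        (∀ d ∈ h.support, (Nat.log 2 n + k) ^ k < d.support.card) →
        2 ^ ((Nat.log 2 n + c) ^ c) <
          complexity (nestFreeMatchingPoly n ℝ≥0 * h) + complexity h) :
    Summit.ValiantsHypothesis.ValiantsHypothesis.Theses.FifoMatching.NNNotVP :=
  Summit.ValiantsHypothesis.ValiantsHypothesis.Theorems.FifoMatching.NNNotVPSplit.nnNotVP_of_subs hZ
    (nnDivisionHard_iff_spreadDenseDeepResidual.mpr hR)

end Summit.ValiantsHypothesis.ValiantsHypothesis.Theorems.FifoMatching.NNDivisionHard.Residual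

end
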